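import Mathlib

/-!
# Both ω-parities of `n² + 1` occur infinitely often

An unconditional, elementary shadow of the crux `QuadraticOmegaParity` (stmt-Parity-11585) for
`f = X² + 1`: each of `(−1)^{ω(n²+1)} = +1` and `(−1)^{ω(n²+1)} = −1` happens for infinitely many
`n` (registered stub `omegaParity_sq_add_one_both_io`).

Proof.  The identity `(u² + u + 1)² + 1 = (u² + 1)·((u + 1)² + 1)` and the fact that a common
prime factor of `u² + 1` and `(u + 1)² + 1` divides `(2u+1)² + 5 − 4(u²+1) − 2(2u+1) = 5` give
`ε(u² + u + 1) = ε(u)·ε(u + 1)·(−1)^{[u ≡ 2 (mod 5)]}` for `ε(n) = (−1)^{ω(n²+1)}`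
(`ω(ab) + #(P(a) ∩ P(b)) = ω(a) + ω(b)` on prime-factor sets, `Nat.primeFactors_mul`).  If `ε = −1` from `N` on, take
`u = 5N`: `ε(u²+u+1) = (−1)(−1) = +1`, contradiction; if `ε = +1` from `N` on, take `u = 5N + 2`:
`ε(u²+u+1) = −(+1)(+1) = −1`, contradiction.  (For Liouville's `λ` the same identity has no sign
flip, which is why `λ(n²+1) = −1` infinitely often is still open — Teräväinen 2024, Problem 3.1.)
Mathlib only; no definitions.
-/

namespace Summit.Parity.BatemanHorn.Theorems

open Polynomial ArithmeticFunction
open scoped ArithmeticFunction.omega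

namespace OmegaParityBothIO

/-- The multiplicative identity `(u² + u + 1)² + 1 = (u² + 1)((u + 1)² + 1)`. [folklore] -/
theorem sq_add_one_mul (u : ℕ) : (u ^ 2 + u + 1) ^ 2 + 1 = (u ^ 2 + 1) * ((u + 1) ^ 2 + 1) := by
  ring

/-- A common prime factor of `u² + 1` and `(u + 1)² + 1` is `5`. [folklore] -/
theorem eq_five_of_dvd {u p : ℕ} (hp : p.Prime) (ha : p ∣ u ^ 2 + 1) (hb : p ∣ (u + 1) ^ 2 + 1) :
    p = 5 := by
  have h1 : p ∣ 2 * u + 1 := by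
    have e : (u + 1) ^ 2 + 1 = (u ^ 2 + 1) + (2 * u + 1) := by ring
    rw [e] at hb
    exact (Nat.dvd_add_right ha).mp hb
  have h2 : p ∣ (2 * u + 1) ^ 2 := by
    rw [sq]
    exact Dvd.dvd.mul_left h1 _
  have h3 : p ∣ (2 * u + 1) ^ 2 + 5 := by
    have e : (2 * u + 1) ^ 2 + 5 = 4 * (u ^ 2 + 1) + 2 * (2 * u + 1) := by ring
    rw [e]
    exact dvd_add (Dvd.dvd.mul_left ha _) (Dvd.dvd.mul_left h1 _)
  have h5 : p ∣ 5 := (Nat.dvd_add_right h2).mp h3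
  exact (Nat.prime_dvd_prime_iff_eq hp Nat.prime_five).mp h5

/-- The common prime factors of `u² + 1` and `(u + 1)² + 1` lie in `{5}`. [folklore] -/
theorem primeFactors_inter_subset (u : ℕ) :
    (u ^ 2 + 1).primeFactors ∩ ((u + 1) ^ 2 + 1).primeFactors ⊆ {5} := by
  intro p hp
  rw [Finset.mem_inter, Nat.mem_primeFactors, Nat.mem_primeFactors] at hp
  rw [Finset.mem_singleton]
  exact eq_five_of_dvd hp.1.1 hp.1.2.1 hp.2.2.1

/-- `(−1)^{ω(ab)} · (−1)^{#(P(a) ∩ P(b))} = (−1)^{ω(a)} · (−1)^{ω(b)}` for `a, b ≠ 0`, where `P(·)` is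
the set of prime factors. [folklore] -/
theorem neg_one_pow_omega_mul {a b : ℕ} (ha : a ≠ 0) (hb : b ≠ 0) :
    (-1 : ℝ) ^ ω (a * b) * (-1 : ℝ) ^ (a.primeFactors ∩ b.primeFactors).card
      = (-1 : ℝ) ^ ω a * (-1 : ℝ) ^ ω b := by
  -- `ω n = #(n.primeFactors)` (Mathlib: `ω n = n.primeFactorsList.dedup.length`), inlined
  simp only [← pow_add, cardDistinctFactors_apply, ← List.card_toFinset, Nat.toFinset_factors,
    Nat.primeFactors_mul ha hb, Finset.card_union_add_card_inter]

/-- The sign flip at `u ≡ 2 (mod 5)`: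
`(−1)^{ω((u²+u+1)²+1)} = −(−1)^{ω(u²+1)} (−1)^{ω((u+1)²+1)}`. [folklore] -/
theorem step_two (u : ℕ) (hu : u % 5 = 2) :
    (-1 : ℝ) ^ ω ((u ^ 2 + u + 1) ^ 2 + 1)
      = -((-1 : ℝ) ^ ω (u ^ 2 + 1) * (-1 : ℝ) ^ ω ((u + 1) ^ 2 + 1)) := by
  have hinter : (u ^ 2 + 1).primeFactors ∩ ((u + 1) ^ 2 + 1).primeFactors = {5} := by
    apply Finset.Subset.antisymm (primeFactors_inter_subset u)
    rw [Finset.singleton_subset_iff, Finset.mem_inter, Nat.mem_primeFactors, Nat.mem_primeFactors]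
    obtain ⟨k, rfl⟩ : ∃ k, u = 5 * k + 2 := ⟨u / 5, by omega⟩
    exact ⟨⟨Nat.prime_five, ⟨5 * k ^ 2 + 4 * k + 1, by ring⟩, by positivity⟩,
      ⟨Nat.prime_five, ⟨5 * k ^ 2 + 6 * k + 2, by ring⟩, by positivity⟩⟩
  have h := neg_one_pow_omega_mul (a := u ^ 2 + 1) (b := (u + 1) ^ 2 + 1)
    (by positivity) (by positivity)
  rw [← sq_add_one_mul, hinter, Finset.card_singleton, pow_one] at h
  calc (-1 : ℝ) ^ ω ((u ^ 2 + u + 1) ^ 2 + 1)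
        = -((-1 : ℝ) ^ ω ((u ^ 2 + u + 1) ^ 2 + 1) * (-1)) := by ring
    _ = _ := by rw [h]

/-- No flip at `u ≡ 0 (mod 5)`:
`(−1)^{ω((u²+u+1)²+1)} = (−1)^{ω(u²+1)} (−1)^{ω((u+1)²+1)}`. [folklore] -/
theorem step_zero (u : ℕ) (hu : u % 5 = 0) :
    (-1 : ℝ) ^ ω ((u ^ 2 + u + 1) ^ 2 + 1)
      = (-1 : ℝ) ^ ω (u ^ 2 + 1) * (-1 : ℝ) ^ ω ((u + 1) ^ 2 + 1) := by
  have hinter : (u ^ 2 + 1).primeFactors ∩ ((u + 1) ^ 2 + 1).primeFactors = ∅ := by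
    rcases Finset.subset_singleton_iff.mp (primeFactors_inter_subset u) with h | h
    · exact h
    · exfalso
      have h5 : 5 ∈ (u ^ 2 + 1).primeFactors ∩ ((u + 1) ^ 2 + 1).primeFactors := by
        rw [h]; exact Finset.mem_singleton_self 5
      rw [Finset.mem_inter, Nat.mem_primeFactors] at h5
      obtain ⟨k, rfl⟩ : ∃ k, u = 5 * k := ⟨u / 5, by omega⟩
      have hd : 5 ∣ 5 * (5 * k ^ 2) + 1 := by
        have e : (5 * k) ^ 2 + 1 = 5 * (5 * k ^ 2) + 1 := by ring
        rw [← e]; exact h5.1.2.1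
      have h1 : 5 ∣ 1 := (Nat.dvd_add_right ⟨5 * k ^ 2, rfl⟩).mp hd
      omega
  have h := neg_one_pow_omega_mul (a := u ^ 2 + 1) (b := (u + 1) ^ 2 + 1)
    (by positivity) (by positivity)
  rwa [← sq_add_one_mul, hinter, Finset.card_empty, pow_zero, mul_one] at h

/-- `X² + 1` evaluated at `n`, through `toNat`, is `n² + 1`. [folklore] -/
theorem eval_toNat (n : ℕ) :
    (((X ^ 2 + 1 : ℤ[X])).eval (n : ℤ)).toNat = n ^ 2 + 1 := by
  simp only [eval_add, eval_pow, eval_X, eval_one]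
  have e : ((n : ℤ) ^ 2 + 1) = ((n ^ 2 + 1 : ℕ) : ℤ) := by push_cast; ring
  rw [e, Int.toNat_natCast]

end OmegaParityBothIO

open OmegaParityBothIO in
/-- **Both ω-parities of `n² + 1` occur infinitely often** (registered stub
`omegaParity_sq_add_one_both_io` of item stmt-Parity-11585): `(−1)^{ω(n²+1)} = +1` for infinitely
many `n` and `= −1` for infinitely many `n`.  Elementary, from
`(u²+u+1)²+1 = (u²+1)((u+1)²+1)` and the sign flip exactly at `u ≡ 2 (mod 5)`. [folklore] -/
theorem omegaParity_sq_add_one_both_io :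
    (∀ N : ℕ, ∃ n : ℕ, N ≤ n ∧ (-1 : ℝ) ^ ArithmeticFunction.cardDistinctFactors
      ((((Polynomial.X ^ 2 + 1 : Polynomial ℤ)).eval (n : ℤ)).toNat) = 1) ∧
    (∀ N : ℕ, ∃ n : ℕ, N ≤ n ∧ (-1 : ℝ) ^ ArithmeticFunction.cardDistinctFactors
      ((((Polynomial.X ^ 2 + 1 : Polynomial ℤ)).eval (n : ℤ)).toNat) = -1) := by
  simp only [eval_toNat]
  have hpm : ∀ n : ℕ, (-1 : ℝ) ^ ω (n ^ 2 + 1) = 1 ∨ (-1 : ℝ) ^ ω (n ^ 2 + 1) = -1 :=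
    fun n => neg_one_pow_eq_or ℝ _
  constructor
  · intro N
    by_contra hN
    push Not at hN
    have hneg : ∀ n : ℕ, N ≤ n → (-1 : ℝ) ^ ω (n ^ 2 + 1) = -1 :=
      fun n hn => (hpm n).resolve_left (hN n hn)
    have h1 := hneg (5 * N) (by omega)
    have h2 := hneg (5 * N + 1) (by omega)
    have h3 := hneg ((5 * N) ^ 2 + 5 * N + 1) (by nlinarith)
    rw [step_zero (5 * N) (by omega), h1, h2] at h3
    norm_num at h3
  · intro N
    by_contra hN
    push Not at hN
    have hpos : ∀ n : ℕ, N ≤ n → (-1 : ℝ) ^ ω (n ^ 2 + 1) = 1 :=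
      fun n hn => (hpm n).resolve_right (hN n hn)
    have h1 := hpos (5 * N + 2) (by omega)
    have h2 := hpos (5 * N + 2 + 1) (by omega)
    have h3 := hpos ((5 * N + 2) ^ 2 + (5 * N + 2) + 1) (by nlinarith)
    rw [step_two (5 * N + 2) (by omega), h1, h2] at h3
    norm_num at h3

end Summit.Parity.BatemanHorn.Theorems
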